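import Summits.AtomisticToContinuum.FouriersLaw.Theses.KineticCorner
import Summits.AtomisticToContinuum.FouriersLaw.Theses.KineticSlab
import Summits.AtomisticToContinuum.FouriersLaw.Theses.KineticSlabContacts
import Summits.AtomisticToContinuum.FouriersLaw.Theorems.EmbeddedDrudeMourreFGRGap
import HarnessLib

/-!
# `NoOddCollisionalInvariant` — no odd continuous collisional invariant on the pinned band
(item stmt-AtomisticToContinuum-3432; crux rank 4 of route `KineticCorner`, support of routes
`KineticSlab` and `KineticSlabContacts`, sub-problem `FouriersLaw`)

Statement (the three route decls are syntactically identical): for `ω(k) = √(ω₂ + 2(1 − cos k))`,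
`ω₂ > 0`, every continuous `2π`-periodic odd `ψ : ℝ → ℝ` with
`ψ(k₁) + ψ(k₂) = ψ(k₃) + ψ(k₁ + k₂ − k₃)` whenever `ω(k₁) + ω(k₂) = ω(k₃) + ω(k₁ + k₂ − k₃)` vanishes
identically — the parity half of ALS's "`ker L = span{1, ω}`" (Aoki–Lukkarinen–Spohn 2006, after
(4.9): "we expect that there are no further solutions, but no proof is available").

Proof (a corollary of the CLOSED crux `FGRGap`, stmt-AtomisticToContinuum-12595, line
fold-jet-rigidity, `Theorems.FGRGap_proof` / `Theorems.FGRGap.hasOddSectorGap_of_pos`): the hypothesis is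
literally `PhononBoltzmann.IsCollisionalInvariant ω₂ ψ` (the tree's `dispersion ω₂ k` unfolds to
`√(ω₂ + 2(1 − cos k))`), so `ψ` is a null vector of the linearised Boltzmann form,
`boltzmannForm ω₂ 1 0 ψ = 0` (`boltzmannForm_eq_zero_of_isCollisionalInvariant`); a continuous periodic
function is bounded, hence `cellNormSq ψ < ∞`; the odd-sector gap `g‖ψ‖² ≤ q(ψ) = 0` with `g > 0`
(`hasOddSectorGap_of_pos ω₂ 1 0`) forces `‖ψ‖²_{L²((−π,π])} = 0`, i.e. `ψ = 0` a.e. on the cell; by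
continuity `ψ = 0` on the open cell `(−π, π)`, at `±π` by oddness + periodicity
(`ψ(π) = ψ(−π) = −ψ(π)`), and everywhere by periodicity.
-/

noncomputable section

namespace Summit.AtomisticToContinuum.FouriersLaw.Theorems.KineticCorner

open MeasureTheory Set Real Filter Topology
open scoped ENNReal
open Literature.MathematicalPhysics.KineticTheory.PhononBoltzmann

/-- A continuous `2π`-periodic function has finite `L²` norm on the Brillouin cell `(−π, π]`.
[folklore] -/
theorem cellNormSq_lt_top_of_continuous_periodic {ψ : ℝ → ℝ} (hcont : Continuous ψ)
    (hper : Function.Periodic ψ (2 * π)) : cellNormSq ψ < ∞ := by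
  -- a continuous periodic function is bounded
  obtain ⟨M, hM⟩ : ∃ M : ℝ, ∀ k : ℝ, |ψ k| ≤ M := by
    have hperabs : Function.Periodic (fun k : ℝ => |ψ k|) (2 * π) := hper.comp fun x => |x|
    have hcpt : IsCompact (Set.range fun k : ℝ => |ψ k|) :=
      hperabs.compact_of_continuous (by positivity) (continuous_abs.comp hcont)
    obtain ⟨M, hM⟩ := hcpt.bddAbove
    exact ⟨M, fun k => hM (Set.mem_range_self k)⟩
  unfold cellNormSq
  have hle : ∀ k : ℝ, ENNReal.ofReal (ψ k ^ 2) ≤ ENNReal.ofReal (M ^ 2) := by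
    intro k
    apply ENNReal.ofReal_le_ofReal
    have h1 : |ψ k| ≤ M := hM k
    have h0 : 0 ≤ |ψ k| := abs_nonneg _
    calc ψ k ^ 2 = |ψ k| ^ 2 := (sq_abs _).symm
      _ ≤ M ^ 2 := by
          exact pow_le_pow_left₀ h0 h1 2
  calc ∫⁻ k in Set.Ioc (-π) π, ENNReal.ofReal (ψ k ^ 2)
      ≤ ∫⁻ _ in Set.Ioc (-π) π, ENNReal.ofReal (M ^ 2) := lintegral_mono fun k => hle k
    _ = ENNReal.ofReal (M ^ 2) * volume (Set.Ioc (-π) π) := by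
        rw [lintegral_const, Measure.restrict_apply MeasurableSet.univ, Set.univ_inter]
    _ < ∞ := by
        refine ENNReal.mul_lt_top ENNReal.ofReal_lt_top ?_
        rw [Real.volume_Ioc]
        exact ENNReal.ofReal_lt_top

/-- An odd continuous `2π`-periodic function whose `L²` norm on the cell vanishes is identically
zero. [folklore] -/
theorem eq_zero_of_cellNormSq_eq_zero {ψ : ℝ → ℝ} (hcont : Continuous ψ)
    (hper : Function.Periodic ψ (2 * π)) (hodd : ∀ k : ℝ, ψ (-k) = -ψ k)
    (h0 : cellNormSq ψ = 0) : ∀ k : ℝ, ψ k = 0 := by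
  -- `ψ² = 0` a.e. on the cell
  have hmeas : Measurable fun k : ℝ => ENNReal.ofReal (ψ k ^ 2) :=
    ENNReal.measurable_ofReal.comp ((continuous_pow 2).measurable.comp hcont.measurable)
  have hae : ∀ᵐ k ∂(volume.restrict (Set.Ioc (-π) π)), ENNReal.ofReal (ψ k ^ 2) = 0 := by
    unfold cellNormSq at h0
    exact (lintegral_eq_zero_iff hmeas).1 h0
  have hae' : ∀ᵐ k ∂(volume.restrict (Set.Ioo (-π) π)), ψ k = (fun _ => (0:ℝ)) k := by
    refine (ae_restrict_of_ae_restrict_of_subset Set.Ioo_subset_Ioc_self hae).mono fun k hk => ?_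
    have h1 : ψ k ^ 2 ≤ 0 := ENNReal.ofReal_eq_zero.1 hk
    have h2 : ψ k ^ 2 = 0 := le_antisymm h1 (sq_nonneg _)
    simpa using pow_eq_zero_iff (n := 2) (two_ne_zero) |>.1 h2
  -- continuity upgrades a.e. to everywhere on the open cell
  have hopen : Set.EqOn ψ (fun _ => (0:ℝ)) (Set.Ioo (-π) π) :=
    Measure.eqOn_open_of_ae_eq hae' isOpen_Ioo hcont.continuousOn continuousOn_const
  -- the endpoint `π`: `ψ π = ψ (-π) = -ψ π`
  have hpi : ψ π = 0 := by
    have h1 : ψ (-π) = ψ π := by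
      have := hper (-π)
      rw [show -π + 2 * π = π by ring] at this
      exact this.symm
    have h2 : ψ (-π) = -ψ π := hodd π
    linarith
  -- reduce a general `k` to the cell by periodicity
  intro k
  obtain ⟨n, hn⟩ : ∃ n : ℤ, k - n • (2 * π) ∈ Set.Ioc (-π) (-π + 2 * π) := by
    refine ⟨toIocDiv Real.two_pi_pos (-π) k, ?_⟩
    exact sub_toIocDiv_zsmul_mem_Ioc Real.two_pi_pos (-π) k
  set k' : ℝ := k - n • (2 * π) with hk'
  have hkk : ψ k = ψ k' := by
    have h := (hper.sub_zsmul_eq n : ψ (k - n • (2 * π)) = ψ k)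
    rw [hk']
    exact h.symm
  rw [hkk]
  rcases eq_or_lt_of_le hn.2 with h | h
  · rw [show -π + 2 * π = π by ring] at h
    rw [h]; exact hpi
  · have hmem : k' ∈ Set.Ioo (-π) π := ⟨hn.1, by linarith⟩
    exact hopen hmem

/-- **No odd continuous collisional invariant on the pinned band** (crux rank 4 of route
`KineticCorner`, item stmt-AtomisticToContinuum-3432), a corollary of the closed crux `FGRGap`:
an odd continuous periodic collisional invariant is an odd `L²` null vector of ALS's linearised
Boltzmann form, which the odd-sector gap excludes. [cite: AokiLukkarinenSpohn2006, §4 eq. (4.9)] -/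
theorem noOddCollisionalInvariant_proof :
    Summit.AtomisticToContinuum.FouriersLaw.Theses.KineticCorner.NoOddCollisionalInvariant := by
  intro ω₂ hω ψ hcont hper hodd hinv
  -- the hypothesis is literally `IsCollisionalInvariant ω₂ ψ`
  have hI : IsCollisionalInvariant ω₂ ψ := fun k₁ k₂ k₃ hk => hinv k₁ k₂ k₃ hk
  -- hence a null vector of the form (on-site vertex `a = 1`, `b = 0`)
  have hq : boltzmannForm ω₂ 1 0 ψ = 0 := boltzmannForm_eq_zero_of_isCollisionalInvariant 1 0 hI
  -- the odd-sector gap (FGRGap, closed) kills odd null vectors of finite norm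
  obtain ⟨g, hg, hgap⟩ := FGRGap.hasOddSectorGap_of_pos ω₂ 1 0 hω one_pos le_rfl
  have hfin : cellNormSq ψ < ∞ := cellNormSq_lt_top_of_continuous_periodic hcont hper
  have hodd' : Function.Odd ψ := fun k => hodd k
  have hle := hgap ψ hper hcont.measurable hodd' hfin
  rw [hq] at hle
  have hzero : cellNormSq ψ = 0 := by
    have h := nonpos_iff_eq_zero.1 hle
    rcases mul_eq_zero.1 h with h1 | h1
    · exact absurd h1 (by simpa using hg)
    · exact h1
  exact eq_zero_of_cellNormSq_eq_zero hcont hper hodd hzero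

/-- The same statement as filed on route `KineticSlab` (shared item stmt-AtomisticToContinuum-3432).
[cite: AokiLukkarinenSpohn2006, §4 eq. (4.9)] -/
theorem noOddCollisionalInvariant_kineticSlab :
    Summit.AtomisticToContinuum.FouriersLaw.Theses.KineticSlab.NoOddCollisionalInvariant :=
  noOddCollisionalInvariant_proof

/-- The same statement as filed on route `KineticSlabContacts` (shared item
stmt-AtomisticToContinuum-3432). [cite: AokiLukkarinenSpohn2006, §4 eq. (4.9)] -/
theorem noOddCollisionalInvariant_kineticSlabContacts :
    Summit.AtomisticToContinuum.FouriersLaw.Theses.KineticSlabContacts.NoOddCollisionalInvariant :=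
  noOddCollisionalInvariant_proof

end Summit.AtomisticToContinuum.FouriersLaw.Theorems.KineticCorner

end
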